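import Mathlib
import Summits.Ventures.HodgeRepro.OcticCMPointTruncFourAll
import Summits.Ventures.HodgeRepro.OcticCMPointEightSign

/-!
# OcticCMPointS3ConjSymplectic — the conjugate-symplectic class at `𝔭 | 5`, conductors `4` and `8`: the sign is the Legendre symbol of the stationary point

Blind re-derivation cell `pub-hodge-repro`, seat night-2 (gen 5).  Target tree path
`lean/Summits/Ventures/HodgeRepro/OcticCMPointS3ConjSymplectic.lean`.  Gen 4's `OcticCMPointDualSign.ConjSymplecticTame`
transcribes, at conductor `2`, the route's class condition `χ′|_{k_v^×} = ω_{K_v/k_v}` (TP1 p0019:L3, ROUTE-B §9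
(E1)/(E2)) as «on the Teichmüller units the character is the quadratic character of the residue field» (the
norm-residue symbol of a tamely ramified quadratic extension restricted to the units — standard local class field
theory, NOT on a held page, hence a DEFINITION), and gets `ε = ω(ϖ)^n χ_quad(β)`.  The same definition at the higher
even conductors gives the same shape:

* **Conductor `4`** (`ConjSymplecticFour`: `ρ(c) = χ_quad(c)` on the constants `c ∈ k^× ⊂ (k[ϖ]/(ϖ⁴))^×`):
  `eps_conjSymplectic_four` — `ε(½, ρ, ψ̃) = ρ(ϖ)^n · χ_quad(c₀)` with `c₀ = (a)_0` the residue of the stationary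
  point (`OcticCMPointTruncFourAll.eps_four_all`: `ρ(c₀)^{−1} = χ_quad(c₀)` since `χ_quad(c₀)² = 1`).
* **Conductor `8`** (`ConjSymplecticEight`: `ρ(u) = χ_quad(ū)` on the `σ`-fixed units of `𝒪/𝔭⁸`, `ū ∈ 𝔽₅` the
  residue `c5((u)_0)`): `eps_conjSymplectic_eight` — `ε(½, ρ, ψ̃) = ρ(ϖ)^n · χ_quad(ā)` with `ā` the residue of the
  stationary point (`OcticCMPointEightSign.eps_eight`; `a₀ ≡ a` mod `5R8` have the same residue).
* **Conjugate-orthogonal** (`ρ = 1` on the `σ`-fixed units): `ε = ρ(ϖ)^n` (`eps_four_all`, `eps_eight_of_trivial`).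

So at every even conductor `2`, `4`, `8` of `𝔭 | 5` the root number of a conjugate-symplectic character is
`ω(ϖ)^n` times the Legendre symbol of the stationary point's residue, and (E2)'s sign is read off from it.

**What this is not.**  The class definitions are transcriptions of the norm-residue symbol, not theorems about it;
odd conductors and the four `χ′_j` are NOT here.  Nothing here says anything about the status of the Hodge conjecture
for CM abelian varieties, which is NOT proved.
-/

set_option autoImplicit false

noncomputable section

open Polynomial Classical

namespace Summit.Ventures.HodgeRepro.PeriodCloser

open GaussSumStability

/-- The quadratic character of `𝔽₅` with values in `ℂ`. -/
def quadChar5C : MulChar (ZMod 5) ℂ := (quadraticChar (ZMod 5)).ringHomComp (Int.castRingHom ℂ)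

/-- `χ_quad(c)² = 1` for `c ≠ 0`. -/
theorem quadChar5C_sq (c : ZMod 5) (hc : c ≠ 0) : quadChar5C c * quadChar5C c = 1 := by
  unfold quadChar5C
  rw [MulChar.ringHomComp_apply, ← map_mul, ← sq, quadraticChar_sq_one hc, map_one]

/-- `χ_quad(c)⁻¹ = χ_quad(c)` for `c ≠ 0`. -/
theorem quadChar5C_inv (c : ZMod 5) (hc : c ≠ 0) : (quadChar5C c)⁻¹ = quadChar5C c := by
  exact inv_eq_of_mul_eq_one_right (quadChar5C_sq c hc)

namespace TruncModel

/-- **The conjugate-symplectic condition at conductor `4`**: on the constants (the Teichmüller units) the character is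
the Legendre symbol. -/
def ConjSymplecticFour (ρ : LocalChar (Trunc (ZMod 5) 4)) : Prop :=
  ∀ c : ZMod 5, ρ.unit (algebraMap (ZMod 5) (Trunc (ZMod 5) 4) c) = quadChar5C c

/-- **The conductor-`4` root number of a conjugate-symplectic character at `𝔭 | 5`**:
`ε(½, ρ, ψ̃) = ρ(ϖ)^n · χ_quad(c₀)`, `c₀` the residue of the stationary point. -/
theorem eps_conjSymplectic_four (ψ₀ : AddChar (ZMod 5) ℂ) (h₀ : ψ₀.IsPrimitive) (n : ℕ)
    (ρ : LocalChar (Trunc (ZMod 5) 4)) (hσ : ∀ x, ρ.unit (conjHom 4 x) = ρ.unit⁻¹ x) (hcs : ConjSymplecticFour ρ)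
    (a : (Trunc (ZMod 5) 4)ˣ) (hρ : LocalChar.Primitive (psiTilde 4 ψ₀) I2 ρ a) :
    LocalChar.eps ((1 / 25 : ℝ) : ℂ) n ρ (psiTilde 4 ψ₀) =
      ρ.piVal ^ n * quadChar5C (coeffAt 4 0 (a : Trunc (ZMod 5) 4)) := by
  obtain ⟨hc₀, -, heps⟩ := eps_four_all_p5 ψ₀ h₀ n ρ hσ a hρ
  rw [heps, hcs, quadChar5C_inv _ hc₀]

end TruncModel

namespace EightModel

/-- `1 ≠ 0` in `𝒪/𝔭⁸` (read off the constant coordinate). -/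
theorem one_ne_zero_R8 : (1 : R8) ≠ 0 := by
  intro h
  have h1 : b4.repr (1 : R8) 0 = 1 := by
    rw [show (1 : R8) = b4 0 by rw [← w_pow_eq_b4]; simp, Module.Basis.repr_self, Finsupp.single_apply, if_pos rfl]
  rw [h] at h1
  simp at h1
  exact absurd h1 (by decide)

/-- The residue `𝒪/𝔭⁸ → 𝔽₅`: the constant coordinate mod `5`. -/
def res (u : R8) : ZMod 5 := c5 (b4.repr u 0)

/-- **The conjugate-symplectic condition at conductor `8`**: on the `σ`-fixed units the character is the Legendre
symbol of the residue. -/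
def ConjSymplecticEight (ρ : LocalChar R8) : Prop :=
  ∀ u : R8ˣ, conj (u : R8) = u → ρ.unit (u : R8) = quadChar5C (res u)

/-- Elements congruent mod `5R8` have the same residue. -/
theorem res_eq_of_sub_mem {u v : R8} (h : u - v ∈ I5) : res u = res v := by
  have h0 := congrFun ((mem_I5_iff_red5 _).1 h) 0
  simp only [red5, map_sub, Finsupp.coe_sub, Pi.sub_apply, Pi.zero_apply] at h0
  unfold res
  exact sub_eq_zero.1 h0

/-- The residue of a unit is non-zero (`5R8 + (w)` is the maximal ideal: a unit is not `≡ 0` mod `(w)`). -/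
theorem res_ne_zero_of_isUnit (u : R8ˣ) : res u ≠ 0 := by
  intro h
  -- write `u = 5b + w·y` ... via the coordinate: `(u)_0 = 5d`, so `u = 5 d + w (c₁ + c₂ w + c₃ w²)` is nilpotent
  obtain ⟨d, hd⟩ := eq_five_mul_of_c5_eq_zero (b4.repr (u : R8) 0) h
  have hu : (u : R8) = 5 * algebraMap (ZMod 25) R8 d +
      w * ((b4.repr (u : R8) 1) • (1 : R8) + (b4.repr (u : R8) 2) • w + (b4.repr (u : R8) 3) • w ^ 2) := by
    conv_lhs => rw [eq_comb (u : R8)]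
    rw [hd, smul_eq_num, map_mul, map_ofNat]
    simp only [smul_eq_num]
    ring
  -- `(5d + w y)^8 = 0`: every term has `5^i w^j` with `4i + j ≥ 8`, and `5 = −w²(... )`... use `w⁸ = 0`, `25 = 0`,
  -- and `5 w^4 = -(w^8) - 5 w^6 ... `: simpler — `(5d + wy)^8 = Σ binom · 5^i d^i w^{8−i} y^{8−i}`; for `i ≥ 2` the
  -- factor `25 = 0`, for `i = 1` the factor `5 w^7 = 5 w^3 · w^4 = 5 w^3 (−5 w² − 5) = 0`, for `i = 0` `w^8 = 0`.
  have h25 := twentyfive_eq_zero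
  have hw8 := w_pow_eight
  have hrel := w_rel
  have h5w7 : (5 : R8) * w ^ 7 = 0 := by
    linear_combination (5 * w ^ 3) * hrel - (w ^ 5 + w ^ 3) * h25
  have hnil : (u : R8) ^ 8 = 0 := by
    rw [hu]
    set dd := algebraMap (ZMod 25) R8 d
    set y := (b4.repr (u : R8) 1) • (1 : R8) + (b4.repr (u : R8) 2) • w + (b4.repr (u : R8) 3) • w ^ 2
    linear_combination (y ^ 8) * hw8 + (8 * dd * y ^ 7) * h5w7 +
      (28 * dd ^ 2 * w ^ 6 * y ^ 6 + 56 * 5 * dd ^ 3 * w ^ 5 * y ^ 5 + 70 * 25 * dd ^ 4 * w ^ 4 * y ^ 4 +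
        56 * 125 * dd ^ 5 * w ^ 3 * y ^ 3 + 28 * 625 * dd ^ 6 * w ^ 2 * y ^ 2 + 8 * 3125 * dd ^ 7 * w * y +
        15625 * dd ^ 8) * h25
  obtain ⟨v, hv⟩ := u.isUnit.exists_right_inv
  have : (1 : R8) = 0 := by
    calc (1 : R8) = ((u : R8) * v) ^ 8 := by rw [hv, one_pow]
      _ = (u : R8) ^ 8 * v ^ 8 := by ring
      _ = 0 := by rw [hnil, zero_mul]
  exact one_ne_zero_R8 this

/-- **The conductor-`8` root number of a conjugate-symplectic character at `𝔭 | 5`**: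
`ε(½, ρ, ψ̃) = ρ(ϖ)^n · χ_quad(ā)`, `ā` the residue of the stationary point. -/
theorem eps_conjSymplectic_eight (n : ℕ) (ρ : LocalChar R8) (hσ : ∀ x, ρ.unit (conj x) = ρ.unit⁻¹ x)
    (hcs : ConjSymplecticEight ρ) (a : R8ˣ) (hρ : LocalChar.Primitive psiTilde I5 ρ a) :
    LocalChar.eps (1 / 625) n ρ psiTilde = ρ.piVal ^ n * quadChar5C (res a) := by
  obtain ⟨a₀, hσa₀, hsub, -, heps⟩ := eps_eight n ρ hσ a hρ
  rw [heps, hcs a₀ hσa₀, ← res_eq_of_sub_mem hsub, quadChar5C_inv _ (res_ne_zero_of_isUnit a)]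

end EightModel

end Summit.Ventures.HodgeRepro.PeriodCloser

end
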